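import Summits.NavierStokesRegularity.NavierStokesRegularity.Theorems.FilamentSkeletonRssCoreLinearInvertibilityRadialBlockToolsA

/-!
# Volterra tools B for crux `CoreLinearInvertibility` (stmt-NavierStokesRegularity-17973), strategist line `Lines/even_volterra.lean`.
In the even sector of the linearisation at the asymmetric Burgers–Gaussian vortex the circular mean `W` of an even
mass-zero vorticity satisfies, in the radial variable, the divergence-form flux ODE `J = r W' + (r²/2) W + μ r² A`,
`J' = r F` (`F` = circular mean of `T_{λ,α} w`, `A` = the `cos 2θ` coefficient of the fluctuation, `μ = λ/4`,
weight `e^{βr²/4} r dr`, `β = 1 − λ ∈ (0,1]`).  The line bounds `W` by the outward Volterra reconstruction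
`P := W − W(0)e^{-r²/4}`, `P' + (r/2)P = q`, `r q = J − μ r² A`, whose weighted energy identity carries the factor `r`
in the coercive term ("Volterra gain": the strain source `μ r A` is then paired with NO weight on `A`).

This file: `volterra_center_abs_le` (`|P(r)| ≤ e^{1/4}∫₀ʳ|q|` on `[0,1]`), `weighted_cs` (weighted Cauchy–Schwarz on
`[0,b]`), `sq_le_of_sq_le_lin`, and the scalar endgame `s2b_algebra` of `volterraProfileBound`.
-/

set_option linter.dupNamespace false

noncomputable section

namespace Summit.NavierStokesRegularity.NavierStokesRegularity.Theorems

open MeasureTheory Filter Topology Set intervalIntegral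

/-- **Sup bound for the outward Volterra reconstruction near the centre.** If `P ∈ C¹`, `P(0) = 0` and
`P' + (r/2)P = q` (continuous), then `|P(r)| ≤ e^{1/4} ∫₀ʳ |q|` for `r ∈ [0,1]`
(`(e^{s²/4}P)' = e^{s²/4} q`). [folklore] -/
theorem volterra_center_abs_le {P P₁ q : ℝ → ℝ} (hP : ∀ r, HasDerivAt P (P₁ r) r)
    (hqc : Continuous q) (hq : ∀ s, P₁ s + s / 2 * P s = q s) (hP0 : P 0 = 0) {r : ℝ} (hr : r ∈ Icc (0:ℝ) 1) :
    |P r| ≤ Real.exp (1 / 4) * ∫ s in (0:ℝ)..r, |q s| := by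
  have hPc : Continuous P := continuous_iff_continuousAt.2 fun s => (hP s).continuousAt
  have hr0 : (0:ℝ) ≤ r := hr.1
  -- FTC for `E(s) = e^{s²/4} P(s)`
  have hE : ∀ s ∈ uIcc 0 r, HasDerivAt (fun t => Real.exp (1 / 4 * t ^ 2) * P t)
      (Real.exp (1 / 4 * s ^ 2) * q s) s := by
    intro s _
    have h1 := hasDerivAt_exp_mul_sq (1 / 4) s
    have h := h1.mul (hP s)
    refine h.congr_deriv ?_
    rw [← hq s]
    ring
  have hc : Continuous fun s => Real.exp (1 / 4 * s ^ 2) * q s := by fun_prop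
  have hftc := intervalIntegral.integral_eq_sub_of_hasDerivAt hE (hc.intervalIntegrable _ _)
  simp only [hP0, mul_zero] at hftc
  have hEq : Real.exp (1 / 4 * r ^ 2) * P r = ∫ s in (0:ℝ)..r, Real.exp (1 / 4 * s ^ 2) * q s := by
    rw [hftc]; simp
  -- bound the integral
  have hbound : |∫ s in (0:ℝ)..r, Real.exp (1 / 4 * s ^ 2) * q s| ≤ ∫ s in (0:ℝ)..r, Real.exp (1 / 4) * |q s| := by
    refine (intervalIntegral.abs_integral_le_integral_abs hr0).trans ?_
    refine intervalIntegral.integral_mono_on hr0 ?_ ?_ fun s hs => ?_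
    · exact (hc.abs).intervalIntegrable _ _
    · exact (continuous_const.mul hqc.abs).intervalIntegrable _ _
    · rw [abs_mul, abs_of_pos (Real.exp_pos _)]
      refine mul_le_mul_of_nonneg_right ?_ (abs_nonneg _)
      apply Real.exp_le_exp.2
      have : s ^ 2 ≤ 1 := by nlinarith [hs.1, hs.2, hr.2]
      linarith
  rw [intervalIntegral.integral_const_mul] at hbound
  have hexp1 : 1 ≤ Real.exp (1 / 4 * r ^ 2) := Real.one_le_exp (by positivity)
  have hPle : |P r| ≤ |Real.exp (1 / 4 * r ^ 2) * P r| := by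
    rw [abs_mul, abs_of_pos (Real.exp_pos _)]
    exact le_mul_of_one_le_left (abs_nonneg _) hexp1
  calc |P r| ≤ |Real.exp (1 / 4 * r ^ 2) * P r| := hPle
    _ = |∫ s in (0:ℝ)..r, Real.exp (1 / 4 * s ^ 2) * q s| := by rw [hEq]
    _ ≤ Real.exp (1 / 4) * ∫ s in (0:ℝ)..r, |q s| := hbound


/-- Weighted Cauchy–Schwarz on `[0,b]` with a nonnegative continuous weight. [folklore] -/
theorem weighted_cs {b : ℝ} (hb : 0 ≤ b) {w u v : ℝ → ℝ} (hw : ∀ r ∈ Icc 0 b, 0 ≤ w r)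
    (hwc : Continuous w) (huc : Continuous u) (hvc : Continuous v) :
    (∫ r in (0:ℝ)..b, w r * u r * v r) ^ 2 ≤
      (∫ r in (0:ℝ)..b, w r * u r ^ 2) * ∫ r in (0:ℝ)..b, w r * v r ^ 2 := by
  have hsc : Continuous fun r => Real.sqrt (w r) := Real.continuous_sqrt.comp hwc
  have hf2 : IntervalIntegrable (fun r => (Real.sqrt (w r) * u r) ^ 2) volume 0 b :=
    ((hsc.mul huc).pow 2).intervalIntegrable _ _
  have hg2 : IntervalIntegrable (fun r => (Real.sqrt (w r) * v r) ^ 2) volume 0 b :=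
    ((hsc.mul hvc).pow 2).intervalIntegrable _ _
  have hfg : IntervalIntegrable (fun r => (Real.sqrt (w r) * u r) * (Real.sqrt (w r) * v r)) volume 0 b :=
    ((hsc.mul huc).mul (hsc.mul hvc)).intervalIntegrable _ _
  have key := sq_intervalIntegral_mul_le hb hf2 hg2 hfg
  have e1 : ∫ r in (0:ℝ)..b, (Real.sqrt (w r) * u r) * (Real.sqrt (w r) * v r) =
      ∫ r in (0:ℝ)..b, w r * u r * v r := by
    refine intervalIntegral.integral_congr fun r hr => ?_
    rw [uIcc_of_le hb] at hr
    have hs : Real.sqrt (w r) * Real.sqrt (w r) = w r := Real.mul_self_sqrt (hw r hr)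
    calc Real.sqrt (w r) * u r * (Real.sqrt (w r) * v r) = (Real.sqrt (w r) * Real.sqrt (w r)) * u r * v r := by ring
      _ = w r * u r * v r := by rw [hs]
  have e2 : ∫ r in (0:ℝ)..b, (Real.sqrt (w r) * u r) ^ 2 = ∫ r in (0:ℝ)..b, w r * u r ^ 2 := by
    refine intervalIntegral.integral_congr fun r hr => ?_
    rw [uIcc_of_le hb] at hr
    have hs : Real.sqrt (w r) ^ 2 = w r := Real.sq_sqrt (hw r hr)
    rw [mul_pow, hs]
  have e3 : ∫ r in (0:ℝ)..b, (Real.sqrt (w r) * v r) ^ 2 = ∫ r in (0:ℝ)..b, w r * v r ^ 2 := by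
    refine intervalIntegral.integral_congr fun r hr => ?_
    rw [uIcc_of_le hb] at hr
    have hs : Real.sqrt (w r) ^ 2 = w r := Real.sq_sqrt (hw r hr)
    rw [mul_pow, hs]
  rw [e1, e2, e3] at key
  exact key

/-- From `x² ≤ c₁ + c₂ x` with `c₁, c₂ ≥ 0` conclude `x² ≤ 2 c₁ + c₂²`. [folklore] -/
theorem sq_le_of_sq_le_lin {x c₁ c₂ : ℝ} (_h1 : 0 ≤ c₁) (_h2 : 0 ≤ c₂) (h : x ^ 2 ≤ c₁ + c₂ * x) :
    x ^ 2 ≤ 2 * c₁ + c₂ ^ 2 := by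
  nlinarith [sq_nonneg (x - c₂)]

set_option maxHeartbeats 800000 in
/-- The scalar endgame of S2b. [folklore] -/
theorem s2b_algebra {β t x f a m n E μ NP NF NA NW : ℝ} (hβ : 0 < β) (hβ1 : β ≤ 1) (ht : t = 1 / β)
    (_hx0 : 0 ≤ x) (hf0 : 0 ≤ f) (ha0 : 0 ≤ a) (hm0 : 0 ≤ m) (hn0 : 0 ≤ n) (_hE0 : 0 ≤ E) (hE2 : E ≤ 2)
    (hxsq : x ^ 2 = NP) (hfsq : f ^ 2 = NF) (hasq : a ^ 2 = NA) (hmsq : m ^ 2 = NF / 2) (hnsq : n ^ 2 = NA / 2)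
    (hmain : (2 - β) / 4 * NP ≤ E * (m + |μ| * n) * m + x * (4 / β * f) + |μ| * (x * a))
    (hpin : NW ≤ 10 / β * NP) :
    NW ≤ 10 ^ 4 / β ^ 3 * (NF + μ ^ 2 * NA) := by
  have ht1 : 1 ≤ t := by rw [ht]; exact (one_le_div hβ).2 hβ1
  have ht0 : 0 ≤ t := by linarith
  have e4 : 4 / β = 4 * t := by rw [ht]; ring
  have e10 : 10 / β = 10 * t := by rw [ht]; ring
  have e104 : (10:ℝ) ^ 4 / β ^ 3 = 10 ^ 4 * t ^ 3 := by rw [ht]; field_simp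
  rw [e4] at hmain
  rw [e10] at hpin
  have hNP0 : 0 ≤ NP := by rw [← hxsq]; positivity
  have hNF0 : 0 ≤ NF := by rw [← hfsq]; positivity
  have hNA0 : 0 ≤ NA := by rw [← hasq]; positivity
  have hμ0 : 0 ≤ |μ| := abs_nonneg _
  have hμNA0 : 0 ≤ μ ^ 2 * NA := by positivity
  -- S1
  have hq : NP / 4 ≤ (2 - β) / 4 * NP := by
    have h0 : 0 ≤ (1 - β) / 4 * NP := mul_nonneg (by linarith) hNP0
    have e : (2 - β) / 4 * NP = NP / 4 + (1 - β) / 4 * NP := by ring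
    linarith
  have hEm : E * (m + |μ| * n) * m ≤ 2 * m ^ 2 + 2 * (|μ| * m * n) := by
    have h0 : 0 ≤ (m + |μ| * n) * m := by positivity
    have h1 := mul_le_mul_of_nonneg_right hE2 h0
    calc E * (m + |μ| * n) * m = E * ((m + |μ| * n) * m) := by ring
      _ ≤ 2 * ((m + |μ| * n) * m) := h1
      _ = 2 * m ^ 2 + 2 * (|μ| * m * n) := by ring
  have S1 : x ^ 2 ≤ (8 * m ^ 2 + 8 * (|μ| * m * n)) + (16 * t * f + 4 * (|μ| * a)) * x := by
    rw [hxsq]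
    have : NP / 4 ≤ 2 * m ^ 2 + 2 * (|μ| * m * n) + x * (4 * t * f) + |μ| * (x * a) := by linarith
    linarith
  have hc1 : 0 ≤ 8 * m ^ 2 + 8 * (|μ| * m * n) := by positivity
  have hc2 : 0 ≤ 16 * t * f + 4 * (|μ| * a) := by positivity
  have S2 := sq_le_of_sq_le_lin hc1 hc2 S1
  -- S3
  have hmn : 2 * (|μ| * m * n) ≤ m ^ 2 + μ ^ 2 * n ^ 2 := by
    have h := sq_nonneg (m - |μ| * n)
    have e : (m - |μ| * n) ^ 2 = m ^ 2 - 2 * (|μ| * m * n) + μ ^ 2 * n ^ 2 := by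
      rw [sub_sq, mul_pow, sq_abs]; ring
    linarith
  have hfa : 2 * (|μ| * f * a) ≤ f ^ 2 + μ ^ 2 * a ^ 2 := by
    have h := sq_nonneg (f - |μ| * a)
    have e : (f - |μ| * a) ^ 2 = f ^ 2 - 2 * (|μ| * f * a) + μ ^ 2 * a ^ 2 := by
      rw [sub_sq, mul_pow, sq_abs]; ring
    linarith
  have htfa : 2 * t * (|μ| * f * a) ≤ t * (f ^ 2 + μ ^ 2 * a ^ 2) := by
    have := mul_le_mul_of_nonneg_left hfa ht0; linarith
  have hc2sq : (16 * t * f + 4 * (|μ| * a)) ^ 2 ≤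
      256 * (t ^ 2 * f ^ 2) + 64 * (t * (f ^ 2 + μ ^ 2 * a ^ 2)) + 16 * (μ ^ 2 * a ^ 2) := by
    have e : (16 * t * f + 4 * (|μ| * a)) ^ 2 =
        256 * (t ^ 2 * f ^ 2) + 64 * (2 * t * (|μ| * f * a)) + 16 * (|μ| ^ 2 * a ^ 2) := by ring
    rw [e, sq_abs]; linarith [htfa]
  have htt : t ≤ t ^ 2 := by
    have h := mul_le_mul_of_nonneg_left ht1 ht0
    rw [mul_one, ← pow_two] at h
    exact h
  have ht23 : t ^ 2 ≤ t ^ 3 := by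
    have h := mul_le_mul_of_nonneg_left ht1 (sq_nonneg t)
    rw [mul_one, ← pow_succ] at h
    exact h
  have ht2 : 1 ≤ t ^ 2 := one_le_pow₀ ht1
  have k1 : NF ≤ t ^ 2 * NF := by
    have h := mul_le_mul_of_nonneg_right ht2 hNF0; rwa [one_mul] at h
  have k2 : t * NF ≤ t ^ 2 * NF := mul_le_mul_of_nonneg_right htt hNF0
  have k3 : μ ^ 2 * NA ≤ t * (μ ^ 2 * NA) := by
    have h := mul_le_mul_of_nonneg_right ht1 hμNA0; rwa [one_mul] at h
  have k4 : t ^ 2 * (μ ^ 2 * NA) ≤ t ^ 3 * (μ ^ 2 * NA) := mul_le_mul_of_nonneg_right ht23 hμNA0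
  have hn2' : μ ^ 2 * n ^ 2 = μ ^ 2 * NA / 2 := by rw [hnsq]; ring
  have htf : t ^ 2 * f ^ 2 = t ^ 2 * NF := by rw [hfsq]
  have htfa2 : t * (f ^ 2 + μ ^ 2 * a ^ 2) = t * NF + t * (μ ^ 2 * NA) := by rw [hfsq, hasq]; ring
  have hμa : μ ^ 2 * a ^ 2 = μ ^ 2 * NA := by rw [hasq]
  have S3 : NP ≤ 332 * (t ^ 2 * NF) + 84 * (t * (μ ^ 2 * NA)) := by
    rw [← hxsq]
    rw [htf, htfa2, hμa] at hc2sq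
    linarith [S2, hmn, hc2sq, hmsq, hn2', k1, k2, k3]
  -- S4
  have ht3 : 0 ≤ t ^ 3 * NF := by positivity
  calc NW ≤ 10 * t * NP := hpin
    _ ≤ 10 * t * (332 * (t ^ 2 * NF) + 84 * (t * (μ ^ 2 * NA))) := mul_le_mul_of_nonneg_left S3 (by positivity)
    _ = 3320 * (t ^ 3 * NF) + 840 * (t ^ 2 * (μ ^ 2 * NA)) := by ring
    _ ≤ 10 ^ 4 * t ^ 3 * (NF + μ ^ 2 * NA) := by
        have h5 : 0 ≤ t ^ 3 * (μ ^ 2 * NA) := mul_nonneg (pow_nonneg ht0 3) hμNA0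
        have e : (10:ℝ) ^ 4 * t ^ 3 * (NF + μ ^ 2 * NA) = 10 ^ 4 * (t ^ 3 * NF) + 10 ^ 4 * (t ^ 3 * (μ ^ 2 * NA)) := by
          ring
        rw [e]; linarith [k4, ht3, h5]
    _ = 10 ^ 4 / β ^ 3 * (NF + μ ^ 2 * NA) := by rw [e104]


end Summit.NavierStokesRegularity.NavierStokesRegularity.Theorems
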